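import Literature.NumberTheory.Transcendental.KZDilationBakerSectorComplexPrep
import Literature.NumberTheory.Transcendental.KZDilationArgHalving
import Mathlib.RingTheory.Algebraic.Integral
import Literature.NumberTheory.Transcendental.KZPeriodsProofs
import HarnessLib

/-!
# Baker normal form of rational one-variable integrands, I: pole terms as real Nash data

Helpers for turning an evaluated complex partial fraction decomposition of a real rational function
into the normal form `ρ' + Σ_k Re(c_k/(x − α_k))` consumed by the complex Baker sector
(`KZ.dilationBakerSectorComplex_lift`):
* (reused: `Literature.NumberTheory.Transcendental.isAlgebraic_re_im` from `KZPeriodsProofs.lean`);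
* the higher pole term `x ↦ Re(κ · ((x − α)^m)⁻¹)` (`κ, α ∈ ℂ` algebraic, `α ∉ (a,b)`): it is
  `ℚ`-semialgebraic and real-analytic on `(a,b)`, and `Re(κ((x−α)^m)⁻¹)' = Re(−mκ((x−α)^{m+1})⁻¹)`
  (`hasDerivAt_re_inv_pow`);
* the simple pole term in the `(p,q,γ,δ)`-parametrisation of `KZDilationBakerSectorComplexPrep`:
  `Re(d/(x − α)) = (γ(−p + (p²+q²)x) + δ q)/((1 − p x)² + (q x)²)` with `p + iq = 1/α`, `γ + iδ = d`
  (`re_div_sub_eq_residue_term`), and the slit condition from `Q ≠ 0` on `(a,b) ∋ 0`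
  (`slit_of_inv_pole`).

Everything is proved; no `def`, no named fact.

## References
* standard. [folklore]
-/

noncomputable section

open Set Filter MvPolynomial Complex
open scoped BigOperators Topology Real ComplexConjugate
open Literature.ModelTheory.ExponentialFields

namespace Literature.NumberTheory.Transcendental

namespace KZ.BakerSectorComplex

/-! ### Real and imaginary parts of algebraic numbers -/

/-- A real number is algebraic iff its image in `ℂ` is. [folklore] -/
theorem isAlgebraic_real_iff (x : ℝ) : IsAlgebraic ℚ (x : ℂ) ↔ IsAlgebraic ℚ x := by
  rw [← Complex.coe_algebraMap]
  exact isAlgebraic_algebraMap_iff (algebraMap ℝ ℂ).injective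

/-! ### The higher pole term `Re(κ ((x − α)^m)⁻¹)` -/

section PoleTerm

variable {a b : ℝ} {α κ : ℂ} {m : ℕ}

/-- `(x − α)^m ≠ 0` for real `x ≠ α`. [folklore] -/
theorem pow_sub_ne_zero {x : ℝ} (hx : (x : ℂ) ≠ α) (m : ℕ) : ((x : ℂ) - α) ^ m ≠ 0 :=
  pow_ne_zero _ (sub_ne_zero.mpr hx)

/-- Real and imaginary parts of `x ↦ κ · ((x − α)^m)⁻¹` are `ℚ`-semialgebraic on `(a,b)` when
`α, κ` are algebraic. [folklore] -/
theorem isSemialgebraicFunOn_re_im_const_mul_inv_pow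
    (hI : IsSemialgebraic ℚ {t : Fin 1 → ℝ | t 0 ∈ Ioo a b})
    (hα : IsAlgebraic ℚ α) (hκ : IsAlgebraic ℚ κ) (m : ℕ) :
    IsSemialgebraicFunOn ℚ {t : Fin 1 → ℝ | t 0 ∈ Ioo a b}
        (fun t => (κ * (((((t 0 : ℝ) : ℂ) - α) ^ m)⁻¹)).re) ∧
      IsSemialgebraicFunOn ℚ {t : Fin 1 → ℝ | t 0 ∈ Ioo a b}
        (fun t => (κ * (((((t 0 : ℝ) : ℂ) - α) ^ m)⁻¹)).im) := by
  -- real and imaginary parts of `u(x) = x − α`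
  have hx : IsSemialgebraicFunOn ℚ {t : Fin 1 → ℝ | t 0 ∈ Ioo a b} (fun t => t 0) := by
    simpa using isSemialgebraicFunOn_aeval hI (X 0 : MvPolynomial (Fin 1) ℚ)
  have hur : IsSemialgebraicFunOn ℚ {t : Fin 1 → ℝ | t 0 ∈ Ioo a b}
      (fun t => ((((t 0 : ℝ) : ℂ) - α)).re) :=
    (hx.fun_sub (isSemialgebraicFunOn_const_of_isAlgebraic hI (isAlgebraic_re_im hα).1)).congr
      fun t _ => by simp
  have hui : IsSemialgebraicFunOn ℚ {t : Fin 1 → ℝ | t 0 ∈ Ioo a b}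
      (fun t => ((((t 0 : ℝ) : ℂ) - α)).im) :=
    (isSemialgebraicFunOn_const_of_isAlgebraic hI (isAlgebraic_re_im hα).2).neg.congr
      fun t _ => by simp
  -- powers
  obtain ⟨hpr, hpi⟩ := KZ.DilationArctanSector.isSemialgebraicFunOn_re_im_pow
    (u := fun x : ℝ => (x : ℂ) - α) hI hur hui m
  -- inverse: `re(z⁻¹) = re z / |z|²`, `im(z⁻¹) = −im z / |z|²`
  have hns : IsSemialgebraicFunOn ℚ {t : Fin 1 → ℝ | t 0 ∈ Ioo a b}
      (fun t => Complex.normSq ((((t 0 : ℝ) : ℂ) - α) ^ m)) :=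
    ((hpr.fun_mul hpr).fun_add (hpi.fun_mul hpi)).congr fun t _ => by
      rw [Complex.normSq_apply]
  have hir : IsSemialgebraicFunOn ℚ {t : Fin 1 → ℝ | t 0 ∈ Ioo a b}
      (fun t => (((((t 0 : ℝ) : ℂ) - α) ^ m)⁻¹).re) :=
    (hpr.fun_mul hns.fun_inv).congr fun t _ => by rw [Complex.inv_re, div_eq_mul_inv]
  have hii : IsSemialgebraicFunOn ℚ {t : Fin 1 → ℝ | t 0 ∈ Ioo a b}
      (fun t => (((((t 0 : ℝ) : ℂ) - α) ^ m)⁻¹).im) :=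
    (hpi.neg.fun_mul hns.fun_inv).congr fun t _ => by
      rw [Complex.inv_im, div_eq_mul_inv]; simp [neg_mul]
  -- constant multiple
  have hκr := isSemialgebraicFunOn_const_of_isAlgebraic hI (isAlgebraic_re_im hκ).1
  have hκi := isSemialgebraicFunOn_const_of_isAlgebraic hI (isAlgebraic_re_im hκ).2
  obtain ⟨h1, h2⟩ := KZ.DilationArctanSector.isSemialgebraicFunOn_re_im_mul
    (u := fun _ : ℝ => κ) (v := fun x : ℝ => (((x : ℂ) - α) ^ m)⁻¹) hκr hκi hir hii
  exact ⟨h1, h2⟩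

/-- `x ↦ κ((x − α)^m)⁻¹` is real-analytic (as a `ℂ`-valued function of the real variable) away from
`α`. [folklore] -/
theorem analyticAt_const_mul_inv_pow {x : ℝ} (hx : (x : ℂ) ≠ α) :
    AnalyticAt ℝ (fun y : ℝ => κ * (((y : ℂ) - α) ^ m)⁻¹) x := by
  have h1 : AnalyticAt ℝ (fun y : ℝ => ((y : ℂ) - α)) x :=
    (Complex.ofRealCLM.analyticAt x).sub analyticAt_const
  exact analyticAt_const.mul ((h1.pow m).inv (pow_sub_ne_zero hx m))

/-- Real part of the pole term is real-analytic away from `α`. [folklore] -/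
theorem analyticAt_re_const_mul_inv_pow {x : ℝ} (hx : (x : ℂ) ≠ α) :
    AnalyticAt ℝ (fun y : ℝ => (κ * (((y : ℂ) - α) ^ m)⁻¹).re) x :=
  (Complex.reCLM.analyticAt _).comp (analyticAt_const_mul_inv_pow hx)

/-- **Derivative of the higher pole term**: for `m ≥ 1`,
`d/dx [κ((x−α)^m)⁻¹] = −m κ ((x−α)^{m+1})⁻¹` (as `ℂ`-valued functions of real `x ≠ α`). [folklore] -/
theorem hasDerivAt_const_mul_inv_pow {x : ℝ} (hx : (x : ℂ) ≠ α) (m : ℕ) :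
    HasDerivAt (fun y : ℝ => κ * (((y : ℂ) - α) ^ m)⁻¹)
      (-(m : ℂ) * κ * (((x : ℂ) - α) ^ (m + 1))⁻¹) x := by
  have hsub : HasDerivAt (fun y : ℝ => (y : ℂ) - α) 1 x := by
    simpa using (Complex.ofRealCLM.hasDerivAt (x := x)).sub_const α
  have hne : (x : ℂ) - α ≠ 0 := sub_ne_zero.mpr hx
  have hpow := hsub.pow m
  have hinv := hpow.inv (pow_ne_zero _ hne)
  have h := hinv.const_mul κ
  have hderiv : κ * (-((m : ℂ) * ((x : ℂ) - α) ^ (m - 1) * 1) / (((x : ℂ) - α) ^ m) ^ 2) =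
      -(m : ℂ) * κ * (((x : ℂ) - α) ^ (m + 1))⁻¹ := by
    rcases Nat.eq_zero_or_pos m with rfl | hm
    · simp
    · obtain ⟨k, rfl⟩ : ∃ k, m = k + 1 := ⟨m - 1, by omega⟩
      simp only [Nat.add_sub_cancel]
      field_simp
      ring
  exact h.congr_deriv hderiv

/-- Derivative of the real part of the higher pole term. [folklore] -/
theorem hasDerivAt_re_const_mul_inv_pow {x : ℝ} (hx : (x : ℂ) ≠ α) (m : ℕ) :
    HasDerivAt (fun y : ℝ => (κ * (((y : ℂ) - α) ^ m)⁻¹).re)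
      ((-(m : ℂ) * κ * (((x : ℂ) - α) ^ (m + 1))⁻¹).re) x := by
  have h := Complex.reCLM.hasFDerivAt.comp_hasDerivAt x (hasDerivAt_const_mul_inv_pow (κ := κ) hx m)
  simpa only [Function.comp_def, Complex.reCLM_apply] using h

end PoleTerm

/-! ### The simple pole term in the `(p, q, γ, δ)` parametrisation -/

/-- `Re(d/(x − α)) = (γ(−p + (p²+q²)x) + δ q)/((1 − p x)² + (q x)²)` with `p + iq = α⁻¹`,
`γ + iδ = d`, for `α ≠ 0` and `x ≠ α` (then `1/(x − α) = −α⁻¹/(1 − α⁻¹ x)`). [folklore] -/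
theorem re_div_sub_eq_residue_term {d α : ℂ} (hα : α ≠ 0) {x : ℝ}
    (hslit : 0 < 1 - α⁻¹.re * x ∨ α⁻¹.im * x ≠ 0) :
    (d / ((x : ℂ) - α)).re =
      (d.re * (-α⁻¹.re + (α⁻¹.re ^ 2 + α⁻¹.im ^ 2) * x) + d.im * α⁻¹.im) /
        ((1 - α⁻¹.re * x) ^ 2 + (α⁻¹.im * x) ^ 2) := by
  have hν : ((α⁻¹.re : ℂ) + (α⁻¹.im : ℂ) * I) = α⁻¹ := Complex.re_add_im _
  have hd : ((d.re : ℂ) + (d.im : ℂ) * I) = d := Complex.re_add_im _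
  have key := re_residue_term d.re d.im (p := α⁻¹.re) (q := α⁻¹.im) hslit
  rw [hν, hd] at key
  rw [← key]
  congr 1
  have hw : (1 : ℂ) - α⁻¹ * (x : ℂ) ≠ 0 := by
    rw [← hν]; exact w_ne_zero hslit
  have hxα : (x : ℂ) - α ≠ 0 := by
    intro h
    apply hw
    have hx' : (x : ℂ) = α := sub_eq_zero.mp h
    rw [hx', inv_mul_cancel₀ hα, sub_self]
  rw [mul_div_assoc', div_eq_div_iff hxα hw]
  field_simp
  ring

/-- **Slit condition from non-vanishing.** If `α ∈ ℂ` is not a real point of `(a,b)` (i.e. every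
real `y ∈ (a,b)` has `(y : ℂ) ≠ α`), `α ≠ 0`, and `a < 0 < b`, then for `x ∈ (a,b)`:
`0 < 1 − Re(α⁻¹) x ∨ Im(α⁻¹) x ≠ 0`. [folklore] -/
theorem slit_of_inv_pole {a b : ℝ} (ha : a < 0) (hb : 0 < b) {α : ℂ} (hα : α ≠ 0)
    (hroot : ∀ y ∈ Ioo a b, (y : ℂ) ≠ α) {x : ℝ} (hx : x ∈ Ioo a b) :
    0 < 1 - α⁻¹.re * x ∨ α⁻¹.im * x ≠ 0 := by
  by_cases h1 : 0 < 1 - α⁻¹.re * x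
  · exact Or.inl h1
  by_cases h2 : α⁻¹.im * x ≠ 0
  · exact Or.inr h2
  exfalso
  have h1 : 1 - α⁻¹.re * x ≤ 0 := not_lt.mp h1
  have h2 : α⁻¹.im * x = 0 := of_not_not h2
  -- `x ≠ 0`
  have hx0 : x ≠ 0 := by
    rintro rfl
    norm_num at h1
  have him : α⁻¹.im = 0 := by
    rcases mul_eq_zero.mp h2 with h | h
    · exact h
    · exact absurd h hx0
  -- so `α⁻¹` and `α` are real
  set p : ℝ := α⁻¹.re with hp
  have hinv : α⁻¹ = (p : ℂ) := by
    apply Complex.ext <;> simp [hp, him]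
  have hp0 : p ≠ 0 := by
    intro h0
    have : α⁻¹ = 0 := by rw [hinv, h0]; simp
    exact (inv_ne_zero hα) this
  have hαre : α = ((p⁻¹ : ℝ) : ℂ) := by
    rw [Complex.ofReal_inv, ← hinv, inv_inv]
  -- `p x ≥ 1`, hence `1/p ∈ (a,b)`: contradiction with `hroot`
  have hpx : 1 ≤ p * x := by linarith
  have hmem : p⁻¹ ∈ Ioo a b := by
    rcases lt_or_gt_of_ne hp0 with hneg | hpos
    · have h3 : x ≤ p⁻¹ := by
        rw [inv_eq_one_div, le_div_iff_of_neg hneg]; linarith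
      exact ⟨lt_of_lt_of_le hx.1 h3, lt_trans (inv_lt_zero.mpr hneg) hb⟩
    · have h3 : p⁻¹ ≤ x := by
        rw [inv_eq_one_div, div_le_iff₀ hpos]; linarith
      exact ⟨lt_trans ha (inv_pos.mpr hpos), lt_of_le_of_lt h3 hx.2⟩
  exact hroot _ hmem hαre.symm

end KZ.BakerSectorComplex

end Literature.NumberTheory.Transcendental
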